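import Summits.QuantumFields.YangMills.Theorems.SwapVirialDeficitBlowUpVirialRing
import Summits.QuantumFields.YangMills.Theorems.SwapVirialDeficitBlowUpGnomonicFollowersWeight
import Summits.QuantumFields.YangMills.Theorems.SwapVirialDeficitSwapMeanActionApriori
import HarnessLib

/-!
# The followers' share of the virial window row is `O(L^{14} log b / b)·Z₀(b)`, uniformly in `L`

In fcl-p3 g46's ✓`virial_ring` (memo2 (V3′) on the ring): `b·E_z(b) = α·Z_z(b) − ½·K_L·⟪gnoW⟫_{z,b} + b·K_L·⟪R⟫_{z,b}`, and the crux's window row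
(D2's `VirialWindow`) asks `½K_L⟪W⟫ − bK_L⟪R⟫ ≤ (1/2 − c)·Z` on `L ≤ b^a`.  Split `gnoW = W_L + W_F` (`gnoW_eq_leaders_add_followers`).  This file bounds the
FOLLOWERS' share of `½K_L⟪W⟫` in the principal sector by the mean deficit, hence — via the window-uniform a-priori ceiling — by `O(L^{14} log b/b)·Z₀(b)`:

* §1 `gnoW_eq_leaders_add_followers`, `followersW_nonneg_le` (`0 ≤ W_F ≤ 4|Fol L|`), ★ `followersW_le_gnoDeficit` (`W_F ≤ 27648·L^{10}·F̂₀`, ✓p825736),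
  `measurable_followersW`;
* §2 (fibrewise) `integrable_followersW_fibre`, `integrable_gnoDeficit_fibre`, ★ `followersW_fibre_le` (`∫ W_F e^{−bF̂₀}ρ ≤ 27648 L^{10} ∫ F̂₀ e^{−bF̂₀}ρ`);
* §3 (ring) `integrable_fibre_followersW`, ★★ `followersW_term_le_meanDeficit` —
  `½·K_L·∫_cone Σ_ε ∫ W_F e^{−bF̂₀}ρ ≤ 13824·L^{10}·E₀(b)`, `E₀(b) = ∫ F^S_0 e^{−bF^S_0} dμ_L` (✓`integral_swapDeficit_exp_eq_gnomonic`), and ★★★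
  `followersW_term_apriori` — ABSOLUTE `K ≥ 0`, `β₀ ≥ 1`: for EVERY `L` and `b ≥ β₀`,
  `½·K_L·∫_cone Σ_ε ∫ W_F e^{−bF̂₀}ρ ≤ 13824·L^{10}·(2(9L⁴−1)·log b + K·L⁴·(1+log L))/b · Z₀(b)` (✓`swap_meanDeficit_apriori`), i.e. the followers' share of
  the window row is `O(L^{14} log b / b)·Z₀(b)` — negligible against `(1/2 − c)·Z₀(b)` on any window `L ≤ b^a`, `a < 1/14`, with NO plaquette-moment input.

HONEST LABEL: one share (followers' `W`, principal sector) of one side of the virial window row; the leaders' `W_L` (valley term), the remainder `b⟪R⟫`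
and the other sectors are untouched; `VirialWindow` ∕ ⟨24197⟩ (window-uniform) OPEN; ⟨24194⟩ ∕ ⟨24497⟩ OPEN; own crux ⟨22884⟩ OPEN (blocked-on ⟨19935⟩);
no crux, rung of record or summit is proved; the Yang–Mills mass gap is NOT proved; no summit is proved by a line.  THEOREMS ONLY (0 `def`, 0 `sorry`),
standard axioms.  Width seat ym-line-sfw-p2-w2 g57 (cell ym-idea-1, free hands), `--supports stmt-QuantumFields-24197`.
References: [cite: Luscher1983, §2]; [cite: Griffiths1964]; [cite: tHooft1979]; [folklore].
-/

set_option autoImplicit false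
set_option synthInstance.maxSize 1024

noncomputable section

open MeasureTheory Quaternion Set Filter Topology
open scoped Quaternion BigOperators
open Literature.MathematicalPhysics.QuantumLattice
open Literature.MathematicalPhysics.QuantumFieldTheory hiding SU2
open Summit.QuantumFields.YangMills.Theorems.FemtoTransferGap
open Summit.QuantumFields.YangMills.Theorems.FemtoTransferGap.TT
open Summit.QuantumFields.YangMills.Theorems.VirialFluxGap.RingDeficit
open Summit.QuantumFields.YangMills.Theorems.SwapTwistDeficit.ToronLog (coneMeasure coneConst coneConst_pos isProbabilityMeasure_coneMeasure)
open Summit.QuantumFields.YangMills.Theorems.SwapVirialDeficit.SwapRing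
open Summit.QuantumFields.YangMills.Theorems.SwapVirialDeficit.Gnomonic (gnomonicW gnomonicW_nonneg_le)

attribute [local instance] Literature.Analysis.FluidPDE.Tao2016.quatMeasurableSpace
  Literature.Analysis.FluidPDE.Tao2016.quatBorelSpace
  Literature.MathematicalPhysics.QuantumLattice.secondCountableTopology_su2

namespace Summit.QuantumFields.YangMills.Theorems.SwapVirialDeficit.BlowUpRing

variable {L : ℕ} [NeZero L]

/-! ## §1 The Euler weight splits into leaders and followers; the followers' part against the deficit -/

/-- `gnoW = W_L + W_F`: three leader letters plus the followers' sum. [folklore] -/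
theorem gnoW_eq_leaders_add_followers (η : GnoCoord L) :
    gnoW η = (gnoWtr η.1.1 + gnoWtr η.1.2 + gnomonicW η.2.1) + ∑ f, gnomonicW (η.2.2 f) := rfl

/-- `0 ≤ W_F ≤ 4·|Fol L|`. [folklore] -/
theorem followersW_nonneg_le (η : GnoCoord L) :
    0 ≤ ∑ f, gnomonicW (η.2.2 f) ∧ ∑ f, gnomonicW (η.2.2 f) ≤ 4 * (Fintype.card (Fol L) : ℝ) := by
  refine ⟨Finset.sum_nonneg fun f _ => (gnomonicW_nonneg_le _).1, ?_⟩
  calc ∑ f, gnomonicW (η.2.2 f) ≤ ∑ _f : Fol L, (4 : ℝ) := Finset.sum_le_sum fun f _ => (gnomonicW_nonneg_le _).2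
    _ = 4 * (Fintype.card (Fol L) : ℝ) := by rw [Finset.sum_const, Finset.card_univ, nsmul_eq_mul]; ring

/-- ★ `W_F ≤ 27648·L^{10}·F̂` in the principal sector (✓`sum_gnomonicW_followers_le_pow_ten`, `gnoDeficit` unfolded). [cite: Luscher1983, §2] -/
theorem followersW_le_gnoDeficit (a : ℍ) (ε : GnoSign L) (η : GnoCoord L) :
    ∑ f, gnomonicW (η.2.2 f) ≤ 27648 * (L : ℝ) ^ 10 * gnoDeficit (fun _ => false) (fun _ => 1) a ε η :=
  sum_gnomonicW_followers_le_pow_ten a ε η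

/-- `W_F` is measurable on `GnoCoord L`. [folklore] -/
theorem measurable_followersW : Measurable fun η : GnoCoord L => ∑ f, gnomonicW (η.2.2 f) := by
  refine Finset.measurable_sum _ fun f _ => ?_
  exact continuous_gnomonicW.measurable.comp ((measurable_pi_apply f).comp (measurable_snd.comp measurable_snd))

/-! ## §2 Fibrewise: `∫ W_F e^{−bF̂}ρ ≤ 27648 L^{10} ∫ F̂ e^{−bF̂}ρ` -/

section Fibre

variable (a : ℍ) (ε : GnoSign L) {b : ℝ}

/-- The followers' weight fibre integrand is integrable. [folklore] -/
theorem integrable_followersW_fibre (z : Fin 3 → Bool) (hb : 0 ≤ b) :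
    Integrable fun η : GnoCoord L => (∑ f, gnomonicW (η.2.2 f)) * Real.exp (-(b * gnoDeficit z (fun _ => 1) a ε η)) * gnoDensity η := by
  refine (integrable_gnoDensity.const_mul (4 * (Fintype.card (Fol L) : ℝ))).mono'
    ((measurable_followersW.mul (((measurable_gnoDeficit z _ a ε).const_mul b).neg.exp)).mul measurable_gnoDensity).aestronglyMeasurable
    (ae_of_all _ fun η => ?_)
  obtain ⟨h0, h4⟩ := followersW_nonneg_le η
  rw [Real.norm_eq_abs, abs_mul, abs_mul, abs_of_nonneg h0, abs_of_pos (gnoDensity_pos η)]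
  have h1 := abs_exp_gnoDeficit_le_one z (fun _ => (1 : SU2)) a ε hb η
  calc (∑ f, gnomonicW (η.2.2 f)) * |Real.exp (-(b * gnoDeficit z (fun _ => 1) a ε η))| * gnoDensity η
      ≤ 4 * (Fintype.card (Fol L) : ℝ) * 1 * gnoDensity η :=
        mul_le_mul_of_nonneg_right (mul_le_mul h4 h1 (abs_nonneg _) (by positivity)) (gnoDensity_pos η).le
    _ = 4 * (Fintype.card (Fol L) : ℝ) * gnoDensity η := by rw [mul_one]

/-- The deficit fibre integrand `F̂ e^{−bF̂} ρ` is integrable (`b > 0`). [folklore] -/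
theorem integrable_gnoDeficit_fibre (z : Fin 3 → Bool) (hb : 0 < b) :
    Integrable fun η : GnoCoord L => gnoDeficit z (fun _ => 1) a ε η * Real.exp (-(b * gnoDeficit z (fun _ => 1) a ε η)) * gnoDensity η := by
  refine (integrable_gnoDensity.const_mul b⁻¹).mono'
    (((measurable_gnoDeficit z _ a ε).mul (((measurable_gnoDeficit z _ a ε).const_mul b).neg.exp)).mul measurable_gnoDensity).aestronglyMeasurable
    (ae_of_all _ fun η => ?_)
  have h0 : 0 ≤ gnoDeficit z (fun _ => (1 : SU2)) a ε η * Real.exp (-(b * gnoDeficit z (fun _ => 1) a ε η)) :=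
    mul_nonneg (gnoDeficit_nonneg z _ a ε η) (Real.exp_pos _).le
  rw [Real.norm_eq_abs, abs_mul, abs_of_nonneg h0, abs_of_pos (gnoDensity_pos η)]
  exact mul_le_mul_of_nonneg_right (mul_exp_neg_mul_le _ hb) (gnoDensity_pos η).le

/-- ★ Fibrewise followers' bound: `∫ W_F e^{−bF̂₀}ρ ≤ 27648·L^{10}·∫ F̂₀ e^{−bF̂₀}ρ`. [cite: Luscher1983, §2] -/
theorem followersW_fibre_le (hb : 0 < b) :
    ∫ η : GnoCoord L, (∑ f, gnomonicW (η.2.2 f)) * Real.exp (-(b * gnoDeficit (fun _ => false) (fun _ => 1) a ε η)) * gnoDensity η ≤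
      27648 * (L : ℝ) ^ 10 *
        ∫ η : GnoCoord L, gnoDeficit (fun _ => false) (fun _ => 1) a ε η * Real.exp (-(b * gnoDeficit (fun _ => false) (fun _ => 1) a ε η)) *
          gnoDensity η := by
  rw [← integral_const_mul]
  refine integral_mono (integrable_followersW_fibre a ε _ hb.le) ((integrable_gnoDeficit_fibre a ε _ hb).const_mul _) fun η => ?_
  have h := followersW_le_gnoDeficit a ε η
  have hE := (Real.exp_pos (-(b * gnoDeficit (fun _ => false) (fun _ => (1 : SU2)) a ε η))).le
  have hρ := (gnoDensity_pos η).le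
  show (∑ f, gnomonicW (η.2.2 f)) * Real.exp (-(b * gnoDeficit (fun _ => false) (fun _ => 1) a ε η)) * gnoDensity η ≤
    27648 * (L : ℝ) ^ 10 * (gnoDeficit (fun _ => false) (fun _ => 1) a ε η * Real.exp (-(b * gnoDeficit (fun _ => false) (fun _ => 1) a ε η)) *
      gnoDensity η)
  rw [show 27648 * (L : ℝ) ^ 10 * (gnoDeficit (fun _ => false) (fun _ => 1) a ε η * Real.exp (-(b * gnoDeficit (fun _ => false) (fun _ => 1) a ε η)) *
      gnoDensity η) = (27648 * (L : ℝ) ^ 10 * gnoDeficit (fun _ => false) (fun _ => 1) a ε η) *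
        Real.exp (-(b * gnoDeficit (fun _ => false) (fun _ => 1) a ε η)) * gnoDensity η by ring]
  exact mul_le_mul_of_nonneg_right (mul_le_mul_of_nonneg_right h hE) hρ

end Fibre

/-! ## §3 The ring: `½K_L·⟪W_F⟫_{0,b} ≤ 13824·L^{10}·E₀(b)` and the window-uniform bound -/

/-- The followers' weight functional `a ↦ Σ_ε ∫ W_F e^{−bF̂}ρ` is cone-integrable. [folklore] -/
theorem integrable_fibre_followersW (z : Fin 3 → Bool) {b : ℝ} (hb : 0 ≤ b) :
    Integrable (fun a : ℍ => ∑ ε : GnoSign L, ∫ η : GnoCoord L,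
      (∑ f, gnomonicW (η.2.2 f)) * Real.exp (-(b * gnoDeficit z (fun _ => 1) a ε η)) * gnoDensity η) coneMeasure :=
  integrable_sum_fibre z (fun _ => 1) (g := fun _ p => ∑ f, gnomonicW (p.2.2.2 f)) (fun _ => (measurable_followersW.comp measurable_snd).aemeasurable)
    (M := 4 * (Fintype.card (Fol L) : ℝ)) (fun _ p => by
      obtain ⟨h0, h1⟩ := followersW_nonneg_le p.2; rw [abs_of_nonneg h0]; exact h1) hb

/-- ★★ **THE FOLLOWERS' SHARE OF `½⟪W⟫` IS DOMINATED BY THE MEAN DEFICIT**: principal sector, every `L`, every `b > 0`,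
`½·K_L·∫_cone Σ_ε ∫ W_F e^{−bF̂₀}ρ ≤ 13824·L^{10}·∫ F^S_0 e^{−bF^S_0} dμ_L` (✓`integral_swapDeficit_exp_eq_gnomonic`). [cite: Luscher1983, §2] -/
theorem followersW_term_le_meanDeficit {b : ℝ} (hb : 0 < b) :
    1 / 2 * ((coneConst ^ 3 / 64 * (1 / (2 * Real.pi ^ 2)) ^ Fintype.card (Fol L)) *
        ∫ a, (∑ ε : GnoSign L, ∫ η : GnoCoord L,
          (∑ f, gnomonicW (η.2.2 f)) * Real.exp (-(b * gnoDeficit (fun _ => false) (fun _ => 1) a ε η)) * gnoDensity η) ∂coneMeasure) ≤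
      13824 * (L : ℝ) ^ 10 * ∫ p, swapRingDeficit L (fun _ => false) p * Real.exp (-(b * swapRingDeficit L (fun _ => false) p)) ∂(ringMeasure L) := by
  rw [integral_swapDeficit_exp_eq_gnomonic (fun _ => false) hb.le]
  have hK : (0 : ℝ) ≤ coneConst ^ 3 / 64 * (1 / (2 * Real.pi ^ 2)) ^ Fintype.card (Fol L) := by have := coneConst_pos; positivity
  have hmono : ∫ a, (∑ ε : GnoSign L, ∫ η : GnoCoord L,
        (∑ f, gnomonicW (η.2.2 f)) * Real.exp (-(b * gnoDeficit (fun _ => false) (fun _ => 1) a ε η)) * gnoDensity η) ∂coneMeasure ≤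
      ∫ a, (27648 * (L : ℝ) ^ 10 * ∑ ε : GnoSign L, ∫ η : GnoCoord L,
        gnoDeficit (fun _ => false) (fun _ => 1) a ε η * Real.exp (-(b * gnoDeficit (fun _ => false) (fun _ => 1) a ε η)) * gnoDensity η) ∂coneMeasure := by
    refine integral_mono (integrable_fibre_followersW _ hb.le) ((integrable_fibre_gnoDeficit _ _ hb).const_mul _) fun a => ?_
    show (∑ ε : GnoSign L, ∫ η : GnoCoord L,
        (∑ f, gnomonicW (η.2.2 f)) * Real.exp (-(b * gnoDeficit (fun _ => false) (fun _ => 1) a ε η)) * gnoDensity η) ≤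
      27648 * (L : ℝ) ^ 10 * ∑ ε : GnoSign L, ∫ η : GnoCoord L,
        gnoDeficit (fun _ => false) (fun _ => 1) a ε η * Real.exp (-(b * gnoDeficit (fun _ => false) (fun _ => 1) a ε η)) * gnoDensity η
    rw [Finset.mul_sum]
    exact Finset.sum_le_sum fun ε _ => followersW_fibre_le a ε hb
  rw [integral_const_mul] at hmono
  have hL : (0 : ℝ) ≤ 27648 * (L : ℝ) ^ 10 := by positivity
  nlinarith [mul_le_mul_of_nonneg_left hmono hK]

/-- ★★★ **THE FOLLOWERS' SHARE OF THE VIRIAL WINDOW ROW, UNIFORMLY IN `L`**: there are ABSOLUTE `K ≥ 0`, `β₀ ≥ 1` such that for EVERY `L ≥ 1`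
and every `b ≥ β₀`,
`½·K_L·∫_cone Σ_ε ∫ W_F e^{−bF̂₀}ρ ≤ 13824·L^{10}·(2(9L⁴ − 1)·log b + K·L⁴·(1 + log L))/b · Z₀(b)`,  `Z₀(b) = ∫ e^{−bF^S_0} dμ_L`
(`followersW_term_le_meanDeficit` + the window-uniform a-priori ceiling ✓`swap_meanDeficit_apriori`) — `O(L^{14} log b / b)·Z₀`, negligible against
`(1/2 − c)·Z₀` on every window `L ≤ b^a`, `a < 1/14`. [cite: Luscher1983, §2] [cite: Griffiths1964] -/
theorem followersW_term_apriori :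
    ∃ K : ℝ, 0 ≤ K ∧ ∃ β₀ : ℝ, 1 ≤ β₀ ∧ ∀ (L : ℕ) [NeZero L] (b : ℝ), β₀ ≤ b →
      1 / 2 * ((coneConst ^ 3 / 64 * (1 / (2 * Real.pi ^ 2)) ^ Fintype.card (Fol L)) *
          ∫ a, (∑ ε : GnoSign L, ∫ η : GnoCoord L,
            (∑ f, gnomonicW (η.2.2 f)) * Real.exp (-(b * gnoDeficit (fun _ => false) (fun _ => 1) a ε η)) * gnoDensity η) ∂coneMeasure) ≤
        13824 * (L : ℝ) ^ 10 * ((2 * (9 * (L : ℝ) ^ 4 - 1) * Real.log b + K * (L : ℝ) ^ 4 * (1 + Real.log L)) / b) *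
          ∫ p, Real.exp (-(b * swapRingDeficit L (fun _ => false) p)) ∂(ringMeasure L) := by
  obtain ⟨K, hK, β₀, hβ₀, h⟩ := swap_meanDeficit_apriori
  refine ⟨K, hK, β₀, hβ₀, fun L _ b hb => ?_⟩
  have hb0 : 0 < b := by linarith
  have h1 := followersW_term_le_meanDeficit (L := L) hb0
  have h2 := h L b hb
  -- `Z₀ > 0` and the product form of the a-priori ceiling
  haveI := isProbabilityMeasure_ringMeasure (L := L)
  have hZ : 0 < ∫ p, Real.exp (-(b * swapRingDeficit L (fun _ => false) p)) ∂(ringMeasure L) :=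
    integral_exp_pos (integrable_exp_swapDeficit (L := L) (fun _ => false) b)
  have e1 : (fun p => Real.exp (-b * swapRingDeficit L (fun _ => false) p)) = fun p => Real.exp (-(b * swapRingDeficit L (fun _ => false) p)) := by
    funext p; rw [neg_mul]
  have e2 : (fun p => swapRingDeficit L (fun _ => false) p * Real.exp (-b * swapRingDeficit L (fun _ => false) p)) =
      fun p => swapRingDeficit L (fun _ => false) p * Real.exp (-(b * swapRingDeficit L (fun _ => false) p)) := by
    funext p; rw [neg_mul]
  rw [e1, e2] at h2
  have hx := (le_div_iff₀' hb0).2 h2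
  have h3 := (div_le_iff₀ hZ).1 hx
  have hL : (0 : ℝ) ≤ 13824 * (L : ℝ) ^ 10 := by positivity
  calc _ ≤ 13824 * (L : ℝ) ^ 10 * ∫ p, swapRingDeficit L (fun _ => false) p * Real.exp (-(b * swapRingDeficit L (fun _ => false) p)) ∂(ringMeasure L) := h1
    _ ≤ 13824 * (L : ℝ) ^ 10 * ((2 * (9 * (L : ℝ) ^ 4 - 1) * Real.log b + K * (L : ℝ) ^ 4 * (1 + Real.log L)) / b *
          ∫ p, Real.exp (-(b * swapRingDeficit L (fun _ => false) p)) ∂(ringMeasure L)) := mul_le_mul_of_nonneg_left h3 hL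
    _ = _ := by ring

end Summit.QuantumFields.YangMills.Theorems.SwapVirialDeficit.BlowUpRing

end
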